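import Summits.ResolutionOfSingularities.ResolutionOfSingularities.Theorems.EquisingularLiftEquisingularLiftNatNoseDirectRung
import Summits.ResolutionOfSingularities.ResolutionOfSingularities.Theorems.EquisingularLiftEquisingularLiftNatResidueHypDefsE5
import Summits.ResolutionOfSingularities.ResolutionOfSingularities.Theorems.EquisingularLiftEquisingularLiftNatCITraceSmoothing
import HarnessLib

/-!
# [OURS · L1 W4.5(b) · EL♮(3) · WIDTH TABLE D11 «Σ5a ci-DIRECT»] RUNGᶜⁱ — (ε″) THE UPSTAIRS SUPPLIER `Direct.hsubci_of_smoothing` AND (ζ″) THE RUNG (R-ν3ᶜⁱ) `nose_ci_rung_three`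
# `(T-k) → p.Prime → … → NoseHypHostedNestEquinodalDirectCIBTriplePrime₂ k 3 H ι → ELNatConclusionO k 3 H ι`

res-L1-w45b-stub-4 g15 (pen by the desk's RULING R72a (iii): «(ε″) `Direct.hsubci_of_smoothing` (= (ε) minus step (1)) + (ζ″) `nose_ci_rung_three` over ✓ K5ⁱ
with the THIRD `Or`-disjunct and a DUMMY hyperplane host (zero engine change)»).  ONE module, TWO theorems, same layout as ✓ `…NatNoseDirectRung` (RUNGᵈ, D9).
The door ν3ᶜⁱ «ci-DIRECT ROUND» `ReachDirectCINose₂ k n T₁ F₉ β T₉ E₉` and the blob `NoseHypHostedNestEquinodalDirectCIBTriplePrime₂` (= the 46th's blob with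
the initial-stage nose rule's door widened to `((ν4 ∨ ν3ᵈ) ∨ ν3ᶜⁱ)`) are res-type-027's ✓ `…NatResidueHypDefsE5` (p705365); the customer of record is
res-L1-w45b-lead-1's space island nose S♯_ν(G₇) (`SHARP7-CERTIFICATE.md` 70f4d67028538f11, panel-certified, desk R72/R72a).

## (ε″) `Direct.hsubci_of_smoothing` — the K5ⁱ engine's HSUBⁱ slot at the door ν3ᶜⁱ

WHAT.  As (ε) ✓ `Direct.hsubd_of_smoothing`: at the INITIAL stage `(ℙ³_O, 𝟙, range (ι ≫ Proj φ))` with the initial host model, every move of the door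
`ReachDirectCINose₂ k 3 (range ι) F₉ β T₉ E₉` (`E₉ = ∅`; a closed infinite `Z ⊆ range ι`, `¬ range ι ⊆ Z`, curve clause, (N1) finitely many non-regular points
of `Z̃`; the ci block `f₁, f₂` homogeneous of degrees `d₁, d₂`, `Z = V₊f₁ ∩ V₊f₂`, `IsRelPrime f₁ f₂`, `f₂ ≠ 0`, `(f₁, f₂)` radical, (HOST-J) `V₊(f₁)` smooth along `Z`;
then the nose blow-up of `𝓘⟨Z⟩` and a B‴ tail, `β = γ' ≫ υ'`) is matched by a new upstairs stage in HSUBʰ's currency with the host dropped.  The rule's `ℓ` and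
the host `E₀ = V₊(ℓ)` are DUMMIES for this door (idea-2's D11 sizing §2: the customer names any hyperplane not containing `range ι`; nothing of it is read).
HOW (pure composition, «(ε) minus step (1)»):  the CENTRE `C₀ := 𝓦` is res-L1-w45b-stub-2's ✓ `Equinodal.ci_trace_smoothing` (`…NatCITraceSmoothing`: the
explicit ci smoothing `V(f̃₁ + ϖU₁, f̃₂ + ϖU₂) ⊂ ℙ³_O` — `V(𝓦)` regular, `O`-flat, `𝓦.comap (Proj φ) = 𝓘⟨Z⟩`) fed `Z`, (N1) and the ci block verbatim; the MOVE is
ONE call of res-L1-w45b-nose-w1's ✓ `Equinodal.directNose_stage_zero_of_model` (`…NatNoseRoundStageOfModel`) exactly as in (ε).  No linear normal form, no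
host transport.
OURS; NOT a statement of any manuscript ([Hironaka2017] is a candidate under adjudication, nothing of it is asserted); AI-written, weaker than expert review.
No `sorry`; standard axioms; DEF-FREE; the residue (T-k) `EmbeddedCurveLiftFact` is a HYPOTHESIS `hF`.  `--supports stmt-ResolutionOfSingularities-20148 --as helper`.
[folklore; pure composition]

## (ζ″) `nose_ci_rung_three` — THE RUNG (R-ν3ᶜⁱ)

WHAT.  Surfaces `H ⊂ ℙ³_k` whose downstairs resolution motive is closed under hosted point steps, stage-level hosted rounds, `ReachHostedNoseBTriplePrime`-moves
and, at the initial stage with hyperplane host `E₀ = V₊(ℓ)`, under ANY of the three initial-stage nose doors ν4 / ν3ᵈ / ν3ᶜⁱ, satisfy EL♮(3)'s conclusion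
`ELNatConclusionO k 3 H ι`, GIVEN (T-k).  The type is the 47th texts' call shape: ✓ `nose_direct_rung_three`'s binder convention VERBATIM with the ONE token
`NoseHypHostedNestEquinodalDirectBTriplePrime₂ ↦ NoseHypHostedNestEquinodalDirectCIBTriplePrime₂` (desk R72a (iii): lead-2's 47th = count-neutral REPLACE of
the nose residue hypothesis `¬(ν4 ∨ ν3ᵈ) ↦ ¬((ν4 ∨ ν3ᵈ) ∨ ν3ᶜⁱ)`).
PROOF = ONE application of ✓ K5ⁱ `target_elnat_of_hostedSubchainResolutionᵢ` at `n := 3`, `ReachH := ReachHostedNoseBTriplePrime`,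
`ReachI := fun ℓ F₉ β T₉ E₉ ↦ (ReachEquinodalPlanarNose₂ k 3 ℓ (range ι) F₉ β T₉ E₉ ∨ ReachDirectPlanarNose₂ k 3 ℓ (range ι) F₉ β T₉ E₉) ∨ ReachDirectCINose₂ k 3 (range ι) F₉ β T₉ E₉`
(027's placement (b″): the old door is the left unit), suppliers BY NAME exactly as ✓ `nose_direct_rung_three` and
`HSUBⁱ := hR.elim (fun hR ↦ hR.elim HSUBᵉ HSUBᵈ) HSUBᶜⁱ` with HSUBᵉ = ✓ `Equinodal.hsube_of_suppliers` (ν4), HSUBᵈ = ✓ `Direct.hsubd_of_smoothing` (ν3ᵈ, `…NatNoseDirectRung`),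
HSUBᶜⁱ = `Direct.hsubci_of_smoothing` (ν3ᶜⁱ, above).
OURS; AI-written, weaker than expert review.  No `sorry`; standard axioms; DEF-FREE; `--supports stmt-ResolutionOfSingularities-20148 --as helper`.  EL♮(3) is NOT
proved here: the rung moves the certified class Σ5a (locally planar complete-intersection noses, incl. S♯_ν(G₇)) inside the door; after the 47th REPLACE the nose
residue reads `¬ NoseHypHostedNestEquinodalDirectCIBTriplePrime₂`; Σ2/Σ3/Σ5b/Σ6 (NO-GO ✓ p703581)/Σ7 stay OUTSIDE by letters (idea-2 NU7 / D11 sizing); resolution in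
positive characteristic is NOT proved anywhere in this tree.
[folklore; pure composition]
-/

set_option linter.dupNamespace false -- mandated namespace `Summit.<Summit>.<Problem>` of this single-conjunct summit
set_option linter.overlappingInstances false -- signatures carry `[IsDomain O] [IsDiscreteValuationRing O]`

noncomputable section

open CategoryTheory CategoryTheory.Limits AlgebraicGeometry TopologicalSpace Topology IsLocalRing
open MvPolynomial
open Literature.AlgebraicGeometry.Resolution
open AlgebraicGeometry.Scheme.IdealSheafData
open Summit.ResolutionOfSingularities.ResolutionOfSingularities.Theses.EquisingularLift.Split
open Summit.ResolutionOfSingularities.ResolutionOfSingularities.Cruxes.EquisingularLift.StrataSplit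

namespace Summit.ResolutionOfSingularities.ResolutionOfSingularities.Cruxes.EquisingularLiftNat.Sections.Direct

/-- ★★ **HSUBᶜⁱ FROM THE ci SMOOTHING — the K5ⁱ engine's HSUBⁱ slot at the door ν3ᶜⁱ `ReachDirectCINose₂ k 3 (range ι)`** (composition: the CENTRE =
res-L1-w45b-stub-2's explicit ci smoothing ✓ `Equinodal.ci_trace_smoothing`, then res-L1-w45b-nose-w1's ✓ `Equinodal.directNose_stage_zero_of_model` = PHASE 2 of
✓ `Equinodal.hsube_of_suppliers`).  Binders = the HSUBⁱ slot of ✓ `target_elnat_of_hostedSubchainResolutionᵢ` at `n := 3` behind `(hF) (k) (H) (ι) (hι) (hH) (E₀)`;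
the rule's `ℓ` / `E₀` are dummies for this door.  [OURS · L1 W4.5b · RUNGᶜⁱ (ε″); NOT a statement of the manuscript; EL♮(3) NOT proved] -/
theorem hsubci_of_smoothing (hF : EmbeddedCurveLiftFact) (k : Type) [Field k] [IsAlgClosed k] (H : Scheme.{0})
    (ι : H ⟶ (Literature.AlgebraicGeometry.Motives.projectiveSpace 3 k).left)
    (hι : AlgebraicGeometry.IsClosedImmersion ι) (hH : AlgebraicGeometry.IsIntegral H)
    (E₀ : Set (Literature.AlgebraicGeometry.Motives.projectiveSpace 3 k).left) :
    ∀ (O : Type) [CommRing O] [IsDomain O] [IsDiscreteValuationRing O] [IsAdicComplete (IsLocalRing.maximalIdeal O) O] [IsAlgClosed (IsLocalRing.ResidueField O)] (θ : O →+* k), Function.Surjective θ →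
      (letI := MvPolynomial.gradedAlgebra (σ := Fin (3 + 1)) (R := O); letI := MvPolynomial.gradedAlgebra (σ := Fin (3 + 1)) (R := k);
       ∀ (φ : MvPolynomial.homogeneousSubmodule (Fin (3 + 1)) O →+*ᵍ MvPolynomial.homogeneousSubmodule (Fin (3 + 1)) k)
        (hφ' : HomogeneousIdeal.irrelevant (MvPolynomial.homogeneousSubmodule (Fin (3 + 1)) k) ≤ (HomogeneousIdeal.irrelevant (MvPolynomial.homogeneousSubmodule (Fin (3 + 1)) O)).map φ), (∀ s, φ s = MvPolynomial.map θ s) →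
      ∀ (Ch : ∀ X' : AlgebraicGeometry.Scheme.{0}, (X' ⟶ (AlgebraicGeometry.Proj (MvPolynomial.homogeneousSubmodule (Fin (3 + 1)) O))) → Set X' → Prop),
        (∀ (X' X'' : AlgebraicGeometry.Scheme.{0}) (σ' : X' ⟶ (AlgebraicGeometry.Proj (MvPolynomial.homogeneousSubmodule (Fin (3 + 1)) O))) (S' : Set X') (C : X'.IdealSheafData) (τ : X'' ⟶ X'), Ch X' σ' S' → Literature.AlgebraicGeometry.Resolution.IsBlowup τ C →
          Literature.AlgebraicGeometry.Resolution.Scheme.IsRegular C.subscheme → AlgebraicGeometry.Flat (C.subschemeι ≫ σ' ≫ (AlgebraicGeometry.Proj.toSpecZero (MvPolynomial.homogeneousSubmodule (Fin (3 + 1)) O) ≫ AlgebraicGeometry.Spec.map (CommRingCat.ofHom (algebraMap O (MvPolynomial.homogeneousSubmodule (Fin (3 + 1)) O 0))))) → σ' '' (C.support : Set X') ⊆ {y | ¬ IsGenericPoint y (Set.range (ι ≫ AlgebraicGeometry.Proj.map φ hφ' : H ⟶ (AlgebraicGeometry.Proj (MvPolynomial.homogeneousSubmodule (Fin (3 + 1))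 O))))} →
          (C.support : Set X') ∩ (σ' ≫ (AlgebraicGeometry.Proj.toSpecZero (MvPolynomial.homogeneousSubmodule (Fin (3 + 1)) O) ≫ AlgebraicGeometry.Spec.map (CommRingCat.ofHom (algebraMap O (MvPolynomial.homogeneousSubmodule (Fin (3 + 1)) O 0))))) ⁻¹' {IsLocalRing.closedPoint O} ⊆ S' → Ch X'' (τ ≫ σ') (closure (τ ⁻¹' (S' \ (C.support : Set X'))))) → (∀ (X' : AlgebraicGeometry.Scheme.{0}) (σ' : X' ⟶ (AlgebraicGeometry.Proj (MvPolynomial.homogeneousSubmodule (Fin (3 + 1)) O))) (S' : Set X'), Ch X' σ' S' →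
          Summit.ResolutionOfSingularities.ResolutionOfSingularities.Theses.EquisingularLift.Split.Chain (AlgebraicGeometry.Proj (MvPolynomial.homogeneousSubmodule (Fin (3 + 1)) O)) (Set.range (ι ≫ AlgebraicGeometry.Proj.map φ hφ' : H ⟶ (AlgebraicGeometry.Proj (MvPolynomial.homogeneousSubmodule (Fin (3 + 1)) O)))) X' σ' S') → (Set.range (ι ≫ AlgebraicGeometry.Proj.map φ hφ' : H ⟶ (AlgebraicGeometry.Proj (MvPolynomial.homogeneousSubmodule (Fin (3 + 1)) O)))) ⊆ (AlgebraicGeometry.Proj.toSpecZero (MvPolynomial.homogeneousSubmodule (Fin (3 + 1)) O) ≫ AlgebraicGeometry.Spec.map (CommRingCat.ofHom (algebraMap O (MvPolynomial.homogeneousSubmodule (Fin (3 + 1)) O 0)))) ⁻¹' {IsLocalRing.closedPoint O} → IsIrreducible (Set.range (ι ≫ AlgebraicGeometry.Proj.map φ hφ' : H ⟶ (AlgebraicGeometry.Proj (MvPolynomial.homogeneousSubmodule (Fin (3 + 1)) O)))) → IsClosed (Set.range (ι ≫ AlgebraicGeometry.Proj.map φ hφ' : H ⟶ (AlgebraicGeometry.Proj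 (MvPolynomial.homogeneousSubmodule (Fin (3 + 1)) O)))) →
        AlgebraicGeometry.IsIntegral (AlgebraicGeometry.Proj (MvPolynomial.homogeneousSubmodule (Fin (3 + 1)) O)) → IsLocallyNoetherian (AlgebraicGeometry.Proj (MvPolynomial.homogeneousSubmodule (Fin (3 + 1)) O)) → Literature.AlgebraicGeometry.Resolution.Scheme.IsRegular (AlgebraicGeometry.Proj (MvPolynomial.homogeneousSubmodule (Fin (3 + 1)) O)) → AlgebraicGeometry.IsProper (AlgebraicGeometry.Proj.toSpecZero (MvPolynomial.homogeneousSubmodule (Fin (3 + 1)) O) ≫ AlgebraicGeometry.Spec.map (CommRingCat.ofHom (algebraMap O (MvPolynomial.homogeneousSubmodule (Fin (3 + 1)) O 0)))) → AlgebraicGeometry.SmoothOfRelativeDimension 3 (AlgebraicGeometry.Proj.toSpecZero (MvPolynomial.homogeneousSubmodule (Fin (3 + 1)) O) ≫ AlgebraicGeometry.Spec.map (CommRingCat.ofHom (algebraMap O (MvPolynomial.homogeneousSubmodule (Fin (3 + 1)) O 0)))) →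
      -- the INITIAL stage and the initial host's model
      Ch (AlgebraicGeometry.Proj (MvPolynomial.homogeneousSubmodule (Fin (3 + 1)) O)) (𝟙 (AlgebraicGeometry.Proj (MvPolynomial.homogeneousSubmodule (Fin (3 + 1)) O))) (Set.range (ι ≫ AlgebraicGeometry.Proj.map φ hφ' : H ⟶ (AlgebraicGeometry.Proj (MvPolynomial.homogeneousSubmodule (Fin (3 + 1)) O)))) →
      TCPlus.LetterDatum O (AlgebraicGeometry.Proj (MvPolynomial.homogeneousSubmodule (Fin (3 + 1)) O)) (AlgebraicGeometry.Proj.toSpecZero (MvPolynomial.homogeneousSubmodule (Fin (3 + 1)) O) ≫ AlgebraicGeometry.Spec.map (CommRingCat.ofHom (algebraMap O (MvPolynomial.homogeneousSubmodule (Fin (3 + 1)) O 0)))) (Set.range (ι ≫ AlgebraicGeometry.Proj.map φ hφ' : H ⟶ (AlgebraicGeometry.Proj (MvPolynomial.homogeneousSubmodule (Fin (3 + 1)) O)))) (Literature.AlgebraicGeometry.Motives.projectiveSpace 3 k).left (AlgebraicGeometry.Proj (MvPolynomial.homogeneousSubmodule (Fin (3 + 1)) O)) (𝟙 (AlgebraicGeometry.Proj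 (MvPolynomial.homogeneousSubmodule (Fin (3 + 1)) O))) (AlgebraicGeometry.Proj.map φ hφ' : (Literature.AlgebraicGeometry.Motives.projectiveSpace 3 k).left ⟶ (AlgebraicGeometry.Proj (MvPolynomial.homogeneousSubmodule (Fin (3 + 1)) O))) E₀ →
      ∀ (ℓ : MvPolynomial (Fin (3 + 1)) k) (F₉ : AlgebraicGeometry.Scheme.{0}) (β : F₉ ⟶ (Literature.AlgebraicGeometry.Motives.projectiveSpace 3 k).left) (T₉ E₉ : Set F₉),
        E₀ = {y : (Literature.AlgebraicGeometry.Motives.projectiveSpace 3 k).left | ℓ ∈ (y : ProjectiveSpectrum (MvPolynomial.homogeneousSubmodule (Fin (3 + 1)) k)).asHomogeneousIdeal} →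
        ReachDirectCINose₂ k 3 (Set.range ι) F₉ β T₉ E₉ →
        ∃ (X₉ : AlgebraicGeometry.Scheme.{0}) (σ₉ : X₉ ⟶ (AlgebraicGeometry.Proj (MvPolynomial.homogeneousSubmodule (Fin (3 + 1)) O))) (S₉ : Set X₉) (j₉ : F₉ ⟶ X₉) (t₉ : F₉ ⟶ AlgebraicGeometry.Spec (.of k)),
          Ch X₉ σ₉ S₉ ∧ AlgebraicGeometry.IsIntegral X₉ ∧ IsLocallyNoetherian X₉ ∧ Literature.AlgebraicGeometry.Resolution.Scheme.IsRegular X₉ ∧ AlgebraicGeometry.IsDominant (σ₉ ≫ (AlgebraicGeometry.Proj.toSpecZero (MvPolynomial.homogeneousSubmodule (Fin (3 + 1)) O) ≫ AlgebraicGeometry.Spec.map (CommRingCat.ofHom (algebraMap O (MvPolynomial.homogeneousSubmodule (Fin (3 + 1)) O 0))))) ∧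
          IsPullback j₉ t₉ (σ₉ ≫ (AlgebraicGeometry.Proj.toSpecZero (MvPolynomial.homogeneousSubmodule (Fin (3 + 1)) O) ≫ AlgebraicGeometry.Spec.map (CommRingCat.ofHom (algebraMap O (MvPolynomial.homogeneousSubmodule (Fin (3 + 1)) O 0))))) (AlgebraicGeometry.Spec.map (CommRingCat.ofHom θ)) ∧ j₉ '' T₉ = S₉ ∧ IsClosed T₉ ∧ IsIrreducible T₉ ∧ AlgebraicGeometry.IsIntegral F₉ ∧
          TCPlus.LetterDatum O (AlgebraicGeometry.Proj (MvPolynomial.homogeneousSubmodule (Fin (3 + 1)) O)) (AlgebraicGeometry.Proj.toSpecZero (MvPolynomial.homogeneousSubmodule (Fin (3 + 1)) O) ≫ AlgebraicGeometry.Spec.map (CommRingCat.ofHom (algebraMap O (MvPolynomial.homogeneousSubmodule (Fin (3 + 1)) O 0)))) (Set.range (ι ≫ AlgebraicGeometry.Proj.map φ hφ' : H ⟶ (AlgebraicGeometry.Proj (MvPolynomial.homogeneousSubmodule (Fin (3 + 1)) O)))) F₉ X₉ σ₉ j₉ E₉) := by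
  classical
  intro O _ _ _ _ _ θ hθ
  letI := MvPolynomial.gradedAlgebra (σ := Fin (3 + 1)) (R := O)
  letI := MvPolynomial.gradedAlgebra (σ := Fin (3 + 1)) (R := k)
  intro φ hφ' hφ Ch hChStep hChSplit hYsp hYirr hYcl hPint hPnoeth hPreg hqprop hqsm hCh₀ h𝓔₀ ℓ F₉ β T₉ E₉ hE hR
  obtain ⟨hE₉, Z, hZ, hZT, hTZ, hZinf, hZdim, hN1, ⟨d₁, d₂, f₁, f₂, hf₁, hf₂, hZeq, hrel, hf₂0, hrad, hJ⟩,
    F₃, υ', hυ', γ', E', Es', Ns', K', htail, -⟩ := hR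
  subst hE₉
  -- THE CENTRE: res-L1-w45b-stub-2's explicit ci smoothing of the reduced complete-intersection trace (host-free: `ℓ`, `E₀` are not read)
  obtain ⟨C₀, hCreg, hCfl, hCj⟩ := Equinodal.ci_trace_smoothing k O θ hθ φ hφ' hφ hPnoeth hPreg hqprop Z hZ hN1
    d₁ d₂ f₁ f₂ hf₁ hf₂ hrel hf₂0 hrad hZeq hJ
  -- the move upstairs: res-L1-w45b-nose-w1's ✓ `directNose_stage_zero_of_model` (stage-0 HEND block from `C₀`, then PHASE 2 of ✓ `hsube_of_suppliers`)
  exact Equinodal.directNose_stage_zero_of_model hF k H ι hι hH O θ hθ φ hφ' hφ Ch hChStep hChSplit hYsp hYirr hYcl hPint hPnoeth hPreg hqprop hqsm hCh₀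
    Z hZ hZT hTZ hZinf hZdim C₀ hCreg hCfl hCj F₃ υ' hυ' F₉ γ' T₉ E' Es' Ns' K' htail

end Summit.ResolutionOfSingularities.ResolutionOfSingularities.Cruxes.EquisingularLiftNat.Sections.Direct

namespace Summit.ResolutionOfSingularities.ResolutionOfSingularities.Cruxes.EquisingularLiftNat.Sections

/-- **THE RUNG (R-ν3ᶜⁱ): surfaces `H ⊂ ℙ³_k` with a hosted-nest / ((EQUINODAL ∨ DIRECT-PLANAR) ∨ ci-DIRECT)-NOSE resolution downstairs (door (ν4 ∨ ν3ᵈ) ∨ ν3ᶜⁱ,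
✓ `…NatResidueHypDefsE5`) satisfy EL♮(3)'s conclusion, given (T-k).**  The type is the 47th texts' call shape: ✓ `nose_direct_rung_three`'s binder convention
with the ONE token `NoseHypHostedNestEquinodalDirectBTriplePrime₂ ↦ NoseHypHostedNestEquinodalDirectCIBTriplePrime₂`.  One application of K5ⁱ with
`ReachI := (ν4 ∨ ν3ᵈ) ∨ ν3ᶜⁱ` and `HSUBⁱ := hR.elim (hR.elim HSUBᵉ HSUBᵈ) HSUBᶜⁱ`. [OURS · L1 W4.5b · rung of the 47th cut; NOT a statement of the manuscript; EL♮(3) NOT proved] -/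
theorem nose_ci_rung_three (p : ℕ) : EmbeddedCurveLiftFact → p.Prime →
    ∀ (k : Type) [Field k] [CharP k p] [IsAlgClosed k] (H : AlgebraicGeometry.Scheme.{0})
    (ι : H ⟶ (Literature.AlgebraicGeometry.Motives.projectiveSpace 3 k).left),
    AlgebraicGeometry.IsClosedImmersion ι → AlgebraicGeometry.IsIntegral H →
    (∀ y : (Literature.AlgebraicGeometry.Motives.projectiveSpace 3 k).left,
      ∃ U : (Literature.AlgebraicGeometry.Motives.projectiveSpace 3 k).left.affineOpens,
        y ∈ (U : (Literature.AlgebraicGeometry.Motives.projectiveSpace 3 k).left.Opens) ∧ (ι.ker.ideal U).IsPrincipal) →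
    NoseHypHostedNestEquinodalDirectCIBTriplePrime₂ k 3 H ι → ELNatConclusionO k 3 H ι := by
  intro hF hp k _ _ _ H ι hι hH hloc hν
  haveI := hι; haveI := hH
  letI := MvPolynomial.gradedAlgebra (σ := Fin (3 + 1)) (R := k)
  obtain ⟨E₀, hE₀, hres⟩ := hν
  -- F4's outer hypothesis on the initial host (the blob's disjunction minus its `¬ range ι ⊆ V₊ ℓ` conjunct); read by JINIT (ν4) and by HSUBᵈ (ν3ᵈ)
  have hE₀' : E₀ = ∅ ∨ ∃ ℓ₀ : MvPolynomial (Fin (3 + 1)) k, ℓ₀.IsHomogeneous 1 ∧ ℓ₀ ≠ 0 ∧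
      E₀ = {y : (Literature.AlgebraicGeometry.Motives.projectiveSpace 3 k).left | ℓ₀ ∈ (y : ProjectiveSpectrum (MvPolynomial.homogeneousSubmodule (Fin (3 + 1)) k)).asHomogeneousIdeal} :=
    hE₀.imp id (fun ⟨ℓ₀, h1, h0, _, h⟩ => ⟨ℓ₀, h1, h0, h⟩)
  -- HINIT by cases on the host; everything else is host-independent
  have HINIT : ∀ (O : Type) [CommRing O] [IsDomain O] [IsDiscreteValuationRing O] [IsAdicComplete (IsLocalRing.maximalIdeal O) O]
      [IsAlgClosed (IsLocalRing.ResidueField O)] (θ : O →+* k), Function.Surjective θ → (letI := MvPolynomial.gradedAlgebra (σ := Fin (3 + 1)) (R := O);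
      letI := MvPolynomial.gradedAlgebra (σ := Fin (3 + 1)) (R := k); ∀ (φ : MvPolynomial.homogeneousSubmodule (Fin (3 + 1)) O →+*ᵍ MvPolynomial.homogeneousSubmodule (Fin (3 + 1)) k)
        (hφ' : HomogeneousIdeal.irrelevant (MvPolynomial.homogeneousSubmodule (Fin (3 + 1)) k) ≤ (HomogeneousIdeal.irrelevant (MvPolynomial.homogeneousSubmodule (Fin (3 + 1)) O)).map φ), (∀ s, φ s = MvPolynomial.map θ s) →
        TCPlus.LetterDatum O (AlgebraicGeometry.Proj (MvPolynomial.homogeneousSubmodule (Fin (3 + 1)) O)) (AlgebraicGeometry.Proj.toSpecZero (MvPolynomial.homogeneousSubmodule (Fin (3 + 1)) O) ≫ AlgebraicGeometry.Spec.map (CommRingCat.ofHom (algebraMap O (MvPolynomial.homogeneousSubmodule (Fin (3 + 1)) O 0)))) (Set.range (ι ≫ AlgebraicGeometry.Proj.map φ hφ' : H ⟶ (AlgebraicGeometry.Proj (MvPolynomial.homogeneousSubmodule (Fin (3 + 1)) O)))) (Literature.AlgebraicGeometry.Motives.projectiveSpace 3 k).left (AlgebraicGeometry.Proj (MvPolynomial.homogeneousSubmodule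 (Fin (3 + 1)) O)) (𝟙 (AlgebraicGeometry.Proj (MvPolynomial.homogeneousSubmodule (Fin (3 + 1)) O))) (AlgebraicGeometry.Proj.map φ hφ' : (Literature.AlgebraicGeometry.Motives.projectiveSpace 3 k).left ⟶ (AlgebraicGeometry.Proj (MvPolynomial.homogeneousSubmodule (Fin (3 + 1)) O))) E₀) := by
    rcases hE₀ with rfl | ⟨ℓ, hℓ1, hℓ0, hHℓ, rfl⟩
    · exact hinit_empty k 3 H ι
    · exact hinit_hyperplane k 2 H ι ℓ hℓ1 hℓ0 hHℓ
  exact target_elnat_of_hostedSubchainResolutionᵢ p hp k 3 H ι hι hH hloc E₀ ReachHostedNoseBTriplePrime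
    (fun ℓ F₉ β T₉ E₉ => (ReachEquinodalPlanarNose₂ k 3 ℓ (Set.range ι) F₉ β T₉ E₉ ∨ ReachDirectPlanarNose₂ k 3 ℓ (Set.range ι) F₉ β T₉ E₉) ∨
      ReachDirectCINose₂ k 3 (Set.range ι) F₉ β T₉ E₉)
    HINIT (TCPlus.hpt_seam k 3) (TCPlus.hround_seam k hF) (hsubh_reachHostedNoseBTriplePrime_of_embeddedCurveLiftFact hF k)
    (fun O _ _ _ _ _ θ hθ φ hφ' hφ Ch hChStep hChSplit hYsp hYirr hYcl hPint hPnoeth hPreg hqprop hqsm hCh₀ h𝓔₀ ℓ' F₉ β T₉ E₉ hE₀ hR =>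
      hR.elim (fun hR => hR.elim
        (fun hR => Equinodal.hsube_of_suppliers hF k O θ hθ _ _ _ Ch hChStep hChSplit hYsp hYirr hYcl hPint hPnoeth hPreg hqprop hqsm ℓ' (Set.range ι)
          (Equinodal.RPlus k O θ _ _ _ Ch)
          (Equinodal.jinit_rPlus₀_of_nearNode k H ι hι hH _ hE₀' (Equinodal.nose_regular_near_node k) O θ hθ φ hφ' hφ Ch hChStep hChSplit hYsp hYirr hYcl
            hPint hPnoeth hPreg hqprop hqsm hCh₀ h𝓔₀ ℓ' hE₀)
          (Equinodal.hnode_rPlus k O θ hθ _ _ _ Ch hChStep hChSplit hYsp hYirr hYcl hPint hPnoeth hPreg hqprop hqsm)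
          (Equinodal.hrdz_rPlus k O θ hθ _ _ _ Ch hChStep hChSplit hYsp hYirr hYcl hPint hPnoeth hPreg hqprop hqsm (hF k O θ hθ _ _))
          (Equinodal.hend_rPlus k O θ _ _ _ Ch) F₉ β T₉ E₉ hR)
        (fun hR => Direct.hsubd_of_smoothing hF k H ι hι hH E₀ hE₀' O θ hθ φ hφ' hφ Ch hChStep hChSplit hYsp hYirr hYcl hPint hPnoeth hPreg hqprop hqsm
          hCh₀ h𝓔₀ ℓ' F₉ β T₉ E₉ hE₀ hR))
        (fun hR => Direct.hsubci_of_smoothing hF k H ι hι hH E₀ O θ hθ φ hφ' hφ Ch hChStep hChSplit hYsp hYirr hYcl hPint hPnoeth hPreg hqprop hqsm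
          hCh₀ h𝓔₀ ℓ' F₉ β T₉ E₉ hE₀ hR))
    hres

end Summit.ResolutionOfSingularities.ResolutionOfSingularities.Cruxes.EquisingularLiftNat.Sections

end
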